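import Summits.QuantumFields.BalabanUV.T4Continuum.Spine.NE1p.DressedSmallFieldComponentsWitness

/-!
# T⁴ programme, spine estimate NE1′ (node O3b/H2) — WITNESS «THE ANCHORED COMPONENT SUM FIRES», PART 2 of 2 (LIVE): the outer-label ∕
# component index of the unit cube has EXACTLY THREE members, the majorant mass is `ε + v` in closed form, and the quantity bounded by
# N0w's END on the datum of PART 1 is NOT zero

Cell `pub-balaban`, sub-cell `t4`, row NE1′ formalisation crew (`t4/formal/NE1p/LEAVES.md` row W53 ∕ DAG N29zzx; INTENT HOME/CLAIMS.log l.20082,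
BOOKED-AHEAD typer R-T127 l.20102; X171 its read), unit `b2b-balaban-t4-ne1p-formalise-leaf-10` (gen 11).  THEOREMS ONLY (+ one closing
`example`); imports PART 1 `Spine/NE1p/DressedSmallFieldComponentsWitness` ONLY (SAME namespace — PART 1's toy DATA in scope; no name of
PART 1 re-declared); nothing restated.
* §1 LOCATED, IN KERNEL: **`termsC_X₀_card = 3`** — at `X₀` the admissible labels are the TWO covered labels (`W′ = ∅`, the ONE covering
  family `{X₀}` by W45's `coveringFamilies_unitCube`, `#JC X₀ = 2` — N0v's THIRD step and N0w's closure fibre run on a 2-element `pi`) and the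
  ONE uncovered label (`W′ = {0}`; the EMPTY family is the only covering family of the empty footprint — W50.1's `coveringFamilies_emptyFootprint` ∕ `powerset_unitCube` BY NAME —, the
  empty choice; N0v's FOURTH step runs on two `W′`-fibres): `Finset.card_sigma` ∕ `Finset.card_pi`, no `decide`; **`majC_sum_X₀ = εC + vC`**
  — the covered fibre carries the member budget `εC` IN FULL across its two inner labels (`Finset.prod_sum` read backwards), the uncovered
  fibre the letter `vC` (`Finset.pi_empty`);
* §2 GENUINE: `actC_X₀` — THREE live terms with ONE common W41 integral (`termAt_coreW_pencil` BY NAME): `act k s X₀ = (cM r∕2)·(εC + vC)·∫ …`;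
  `actC_real_sub_zero`, `actC_live` (W33 `integral_incr_pos`), `norm_actC_X₀_lt_one` (`εC + vC ≤ 1`, W41 `norm_term_le`), **`componentsEnd_live`**
  (W24 `exp_locE_cube`): the END's bounded quantity is NOT zero; closing `example`: PART 1's bound AND liveness on the same datum.

WORDING OF RECORD and HONEST FRAMING: as PART 1, verbatim — a DECIDED TOY; `cl = id`, `ℓ = 1` single-scale (closure ∕ (2.36) ∕ anchor count
for Bałaban's domains NOT modelled — S44 ∕ S41); weights CHOSEN ((B3-amp) UNPRINTED for Bałaban's cores, G-ne9p2-5); (B1b) NOT claimed; no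
numeral of [Balaban1988RGII] asserted; 0 binders instantiated on Bałaban's densities; no wall item; wall v1.7 (T4-DAG v46) does NOT move;
R-t4r2-Q2 NOT met thereby; NE1′ ⇐ the named binders — NOT proved, NOT printed; spine PROVED 0∕9; count 9 unchanged; 0 sorry, 0 cite, 0 def,
0 `attribute`; ABSOLUTE RULE honoured.  Rung (B)+1 on ONE finite four-torus — NOT infinite volume, NOT a mass gap, NOT OS on ℝ⁴, NOT Clay.
HONEST DEPENDENCY: continuum YM on T⁴ ⇐ BetaPertH ∧ nine spine estimates (0/9 proved); BetaPertH ⇐ (D1) ∧ (D4) ∧ CAP+tail; G-an2-4 gates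
asym, D1 and NE2/3/4.
-/

noncomputable section

namespace Summit.QuantumFields.BalabanUV.T4Continuum.NE1p.DressedSmallFieldComponentsWitness

open Set Metric MeasureTheory Complex
open scoped BigOperators
open Literature.MathematicalPhysics.QuantumFieldTheory.Balaban1983to89.B12TreeDecay (K₀ K₀_pos)
open Literature.MathematicalPhysics.QuantumFieldTheory.Balaban1983to89.B13Resummation (locE)
open Literature.MathematicalPhysics.QuantumFieldTheory.Balaban1983to89.B13FamilySum (coveringFamilies mem_coveringFamilies)
open Literature.MathematicalPhysics.QuantumFieldTheory.Balaban1983to89.TreeLengthTorus (TPt TDom tsys torusTreeLen)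
open Literature.MathematicalPhysics.QuantumFieldTheory.Balaban1983to89.TreeLengthTorusGeometry (tgeometry TTouch)
open Summit.QuantumFields.BalabanUV.T4Continuum.B13HistMeasurable (B13HistM)
open Summit.QuantumFields.BalabanUV.T4Continuum.B13HistWitness (toyFrame)
open Summit.QuantumFields.BalabanUV.T4Continuum.NE1p.DressedSmallFieldTorusWitness (X₀ X₀_val eq_X₀_iff dressedConst_le_one exp_locE_cube)
open Summit.QuantumFields.BalabanUV.T4Continuum.NE1p.DressedSmallFieldCoresWitness (E1 crd liveTable coreW Acst Acst_pos incr
  integral_incr_pos)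
open Summit.QuantumFields.BalabanUV.T4Continuum.NE1p.DressedSmallFieldCoresMassWitness (cM cM_pos)
open Summit.QuantumFields.BalabanUV.T4Continuum.NE1p.DressedSmallFieldDepCoresWitness (dj_X₀ termAt_coreW_pencil closedForm_real_sub_zero
  norm_term_le)
open Summit.QuantumFields.BalabanUV.T4Continuum.NE1p.DressedSmallFieldFamiliesWitness (coveringFamilies_unitCube)
open Summit.QuantumFields.BalabanUV.T4Continuum.NE1p.DressedSmallFieldInnerLabelsWitness (RI coveringFamilies_emptyFootprint powerset_unitCube)

section Torus
variable (N : ℕ) [NeZero N]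

/-! ## §1 LOCATED, IN KERNEL: at the unit cube there are EXACTLY THREE admissible outer labels -/

open Classical in
/-- **THE OUTER-LABEL INDEX OF THE UNIT CUBE, ENUMERATED** [decided, kernel]: `termsC X₀` is the sigma over `W′ ∈ {∅, {0}}` of: for
`W′ = ∅` the ONE covering family `{X₀}` (W45's `coveringFamilies_unitCube`) with its `#J X₀ = 2` inner choices; for `W′ = {0}` the ONE
(empty) covering family of `∅` with its one (empty) choice — `2 + 1 = 3` labels.  N0v's FOURTH step (two `W′`-fibres) and THIRD step
(a 2-choice `pi`) and N0w's closure fibre all run NON-VACUOUSLY inside the END. [folklore] -/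
theorem termsC_X₀_card : (termsC N (X₀ N)).card = 3 := by
  -- the empty footprint is covered by the empty family only: W50.1's `coveringFamilies_emptyFootprint` BY NAME (stated at
  -- `Finset (TDom 4 N)` by `exact`, since `rw` does not see through `(tsys 4 N).Dom = TDom 4 N`)
  have hempty : coveringFamilies (Finset.univ : Finset (TDom 4 N)) (tgeometry 4 N).cubes ∅ = {∅} :=
    coveringFamilies_emptyFootprint (tgeometry 4 N)
  unfold termsC
  rw [show (tgeometry 4 N).cubes (X₀ N) = {0} from X₀_val N, Finset.card_sigma, powerset_unitCube N, Finset.sum_insert (by simp),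
    Finset.sum_singleton]
  rw [Finset.sdiff_empty, Finset.sdiff_self, coveringFamilies_unitCube, hempty, Finset.card_sigma, Finset.card_sigma,
    Finset.sum_singleton, Finset.sum_singleton, Finset.card_pi, Finset.card_pi, Finset.prod_singleton, Finset.prod_empty, JC_card]
  norm_num

open Classical in
/-- **THE MAJORANT MASS OF THE UNIT CUBE IN CLOSED FORM**: `Σ_{l ∈ termsC X₀} maj l = ε + v` — the covered fibre carries the member
budget `ε` IN FULL across its two inner labels (N0v's `Finset.prod_sum` read backwards), the uncovered fibre the letter `v`. [folklore] -/
theorem majC_sum_X₀ : ∑ l ∈ termsC N (X₀ N), majC N l = εC N + vC N := by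
  -- the empty footprint is covered by the empty family only: W50.1's `coveringFamilies_emptyFootprint` BY NAME (stated at
  -- `Finset (TDom 4 N)` by `exact`, since `rw` does not see through `(tsys 4 N).Dom = TDom 4 N`)
  have hempty : coveringFamilies (Finset.univ : Finset (TDom 4 N)) (tgeometry 4 N).cubes ∅ = {∅} :=
    coveringFamilies_emptyFootprint (tgeometry 4 N)
  -- the covered fibre: `W′ = ∅`, the ONE family `{X₀}`, TWO inner labels — the member budget `ε` IN FULL
  have hA : ∑ s ∈ (coveringFamilies (Finset.univ : Finset (TDom 4 N)) (tgeometry 4 N).cubes ({0} \ ∅)).sigma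
      (fun F => F.pi (JC N)), majC N ⟨∅, s⟩ = εC N := by
    rw [Finset.sdiff_empty, coveringFamilies_unitCube, Finset.sum_sigma, Finset.sum_singleton]
    unfold majC
    simp only [Finset.card_empty, pow_zero, one_mul]
    rw [← Finset.prod_sum {X₀ N} (JC N) (fun _ j => εC N * mC N j.1 j.2), Finset.prod_singleton, JC_eq, Finset.sum_sigma,
      Finset.sum_singleton, Fintype.sum_bool]
    simp only [mC, dj_X₀, mul_zero, neg_zero, Real.exp_zero, mul_one]
    ring
  -- the uncovered fibre: `W′ = {0}`, the EMPTY family, the empty choice — the letter `v`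
  have hB : ∑ s ∈ (coveringFamilies (Finset.univ : Finset (TDom 4 N)) (tgeometry 4 N).cubes ({0} \ {0})).sigma
      (fun F => F.pi (JC N)), majC N ⟨{0}, s⟩ = vC N := by
    rw [Finset.sdiff_self, hempty, Finset.sum_sigma, Finset.sum_singleton, Finset.pi_empty, Finset.sum_singleton]
    unfold majC
    rw [Finset.card_singleton, pow_one, Finset.attach_empty, Finset.prod_empty, mul_one]
  unfold termsC
  rw [show (tgeometry 4 N).cubes (X₀ N) = {0} from X₀_val N, Finset.sum_sigma, powerset_unitCube N, Finset.sum_insert (by simp),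
    Finset.sum_singleton, hA, hB]

/-! ## §2 GENUINE: on `X₀` the activity is THREE live terms with ONE common integral, and the END's bounded quantity is NOT zero -/

variable (r : ℝ) (hr : 0 ≤ r)

open Classical in
/-- **THE ACTIVITY AT `X₀` IN CLOSED FORM**: `act k s X₀ = (cM r∕2)·(ε + v)·∫ e^{s·r·e^{−(v 0)²}}·e^{−‖v‖²} dv` — every label's core has the SAME
W41 integral (`termAt_coreW_pencil` BY NAME), the weights add up by `majC_sum_X₀`. [folklore] -/
theorem actC_X₀ (k : ℕ) (s : ℂ) :
    actC N r hr k s (X₀ N) = ((cM r / 2 * (εC N + vC N) : ℝ) : ℂ) *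
      ∫ v : E1, cexp (s * ((r : ℂ) * (Real.exp (-(crd v ^ 2)) : ℂ))) * cexp (-(((‖v‖ ^ 2 : ℝ) : ℂ))) := by
  unfold actC
  simp only [GC_apply, termAt_coreW_pencil]
  rw [← Finset.sum_mul, ← majC_sum_X₀ N, Finset.mul_sum]
  push_cast
  unfold cC
  push_cast
  rfl

/-- The increment between a REAL source `t` and `0` at `X₀`: `(cM r∕2)(ε+v)·∫ incr (t·r)` (W41's `closedForm_real_sub_zero`). [folklore] -/
theorem actC_real_sub_zero (k : ℕ) (t : ℝ) :
    actC N r hr k (t : ℂ) (X₀ N) - actC N r hr k 0 (X₀ N) =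
      ((cM r / 2 * (εC N + vC N) : ℝ) : ℂ) * ((∫ v, incr (t * r) v : ℝ) : ℂ) := by
  rw [actC_X₀, actC_X₀]
  exact closedForm_real_sub_zero _ r hr t

/-- **THE ATTACHED PART OF THE ACTIVITY IS NOT ZERO** (`(cM r∕2)(ε + v) > 0`, W33's `∫ incr r > 0` for `0 < r`). [folklore] -/
theorem actC_live (hr0 : 0 < r) (k : ℕ) : actC N r hr k 1 (X₀ N) ≠ actC N r hr k 0 (X₀ N) := by
  intro h
  have h0 := sub_eq_zero.2 h
  rw [show (1 : ℂ) = ((1 : ℝ) : ℂ) from Complex.ofReal_one.symm, actC_real_sub_zero, one_mul] at h0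
  have hc : 0 < cM r / 2 * (εC N + vC N) := mul_pos (half_pos (cM_pos r)) (by linarith [εC_pos N, vC_pos N])
  rcases mul_eq_zero.1 h0 with hc0 | hI
  · exact hc.ne' (by exact_mod_cast hc0)
  · exact (integral_incr_pos r hr0).ne' (by exact_mod_cast hI)

/-- The activities at `X₀` lie STRICTLY inside the unit disc for `‖s‖ ≤ 2` (`ε + v ≤ 1`, W41's `norm_term_le`, `A ≤ 1`, `√π < √(2π)`). [folklore] -/
theorem norm_actC_X₀_lt_one (k : ℕ) {s : ℂ} (hs : ‖s‖ ≤ 2) : ‖actC N r hr k s (X₀ N)‖ < 1 := by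
  rw [actC_X₀]
  have hp0 : 0 ≤ εC N + vC N := by linarith [εC_pos N, vC_pos N]
  have hp1 := εC_add_vC_le_one N
  have hπ : 0 < Real.sqrt Real.pi := Real.sqrt_pos.2 Real.pi_pos
  have hlt : Real.sqrt Real.pi < Real.sqrt (2 * Real.pi) := Real.sqrt_lt_sqrt Real.pi_pos.le (by linarith [Real.pi_pos])
  have hq : Real.sqrt Real.pi / Real.sqrt (2 * Real.pi) < 1 := (div_lt_one (hπ.trans hlt)).2 hlt
  have hA : Acst ≤ 1 := dressedConst_le_one
  have hb := norm_term_le r hr hs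
  have hn : ‖((cM r / 2 * (εC N + vC N) : ℝ) : ℂ) * ∫ v : E1, cexp (s * ((r : ℂ) * (Real.exp (-(crd v ^ 2)) : ℂ))) *
        cexp (-(((‖v‖ ^ 2 : ℝ) : ℂ)))‖ =
      (εC N + vC N) * ‖((cM r / 2 : ℝ) : ℂ) * ∫ v : E1, cexp (s * ((r : ℂ) * (Real.exp (-(crd v ^ 2)) : ℂ))) *
        cexp (-(((‖v‖ ^ 2 : ℝ) : ℂ)))‖ := by
    rw [norm_mul, norm_mul, Complex.norm_real, Complex.norm_real, Real.norm_eq_abs, Real.norm_eq_abs, abs_mul, abs_of_nonneg hp0]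
    ring
  rw [hn]
  calc (εC N + vC N) * ‖((cM r / 2 : ℝ) : ℂ) * ∫ v : E1, cexp (s * ((r : ℂ) * (Real.exp (-(crd v ^ 2)) : ℂ))) *
          cexp (-(((‖v‖ ^ 2 : ℝ) : ℂ)))‖
      ≤ 1 * (Acst / 2 * (Real.sqrt Real.pi / Real.sqrt (2 * Real.pi))) := mul_le_mul hp1 hb (norm_nonneg _) zero_le_one
    _ < 1 := by
        rw [one_mul]
        have := Acst_pos
        nlinarith

open Classical in
/-- **THE END's BOUNDED QUANTITY IS NOT ZERO** [decided toy]: equal dressed outputs on the cube would give equal activities at `X₀` (W24's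
`exp_locE_cube` BY NAME), contradicting `actC_live`. [folklore] -/
theorem componentsEnd_live (hr0 : 0 < r) (k : ℕ) :
    locE (tgeometry 4 N).ι (tgeometry 4 N).cubes (actC N r hr k 1) ((tgeometry 4 N).cubes (X₀ N)) ≠
      locE (tgeometry 4 N).ι (tgeometry 4 N).cubes (actC N r hr k 0) ((tgeometry 4 N).cubes (X₀ N)) := by
  intro h
  have h1 := exp_locE_cube N (w := actC N r hr k 1) (norm_actC_X₀_lt_one N r hr k (by simp))
  have h0 := exp_locE_cube N (w := actC N r hr k 0) (norm_actC_X₀_lt_one N r hr k (by simp))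
  have h' : cexp (locE (TTouch (d := 4) (N := N)) (fun Z : (tsys 4 N).Dom => Z.1) (actC N r hr k 1) {0}) =
      cexp (locE (TTouch (d := 4) (N := N)) (fun Z : (tsys 4 N).Dom => Z.1) (actC N r hr k 0) {0}) := congrArg cexp h
  rw [h1, h0, add_right_inj] at h'
  exact actC_live N r hr hr0 k h'

open Classical in
/-- **THE END FIRES ON A LIVE DATUM**: N0w's bound holds AND the bounded quantity is not zero. [folklore] -/
example (hr0 : 0 < r) (k : ℕ) :
    locE (tgeometry 4 N).ι (tgeometry 4 N).cubes (actC N r hr k 1) ((tgeometry 4 N).cubes (X₀ N)) ≠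
        locE (tgeometry 4 N).ι (tgeometry 4 N).cubes (actC N r hr k 0) ((tgeometry 4 N).cubes (X₀ N)) ∧
      ‖locE (tgeometry 4 N).ι (tgeometry 4 N).cubes (actC N r hr k 1) ((tgeometry 4 N).cubes (X₀ N)) -
          locE (tgeometry 4 N).ι (tgeometry 4 N).cubes (actC N r hr k 0) ((tgeometry 4 N).cubes (X₀ N))‖ ≤ K₀ 64 8 :=
  ⟨componentsEnd_live N r hr hr0 k, componentsEnd_fires_closed N r hr k⟩

end Torus

end Summit.QuantumFields.BalabanUV.T4Continuum.NE1p.DressedSmallFieldComponentsWitness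

end
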